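import Summits.ABC.ABC.Theses.GaussianTwoDivision
import HarnessLib

/-!
# Route `GaussianTwoDivision` — item `Assembly` (stmt-ABC-23404)

`Assembly := GaussianNormTripleBound → TwoTorsionDictionary → GaussianPayoff → GaussianResidual →
ABC` is literally the planner's deciding theorem `closes` of the route file (pure logic:
`h₄ (h₃ h₁ h₂)`). Cell `abc-harv`, seat pr-4.

HONESTY. Content-free bookkeeping: an implication chain whose first hypothesis is the OPEN crux
`GaussianNormTripleBound` (stmt-ABC-23401, not touched) and whose last hypothesis
`GaussianResidual` is a DECLARED residual of summit strength (abc off the class). The route is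
booked STRIKE@A0 as filed (critic idea-crit-6, 2026-08-27): landing this implication is NOT abc
progress, NOT A-PS, and asserts the truth of none of its hypotheses; it moves no rung of
LADDER-ABC. Closed inputs of the chain: `TwoTorsionDictionary` (stmt-ABC-23398) and
`GaussianPayoff` (stmt-ABC-23403).
-/

-- `Summit.<Summit>.<Problem>` is the mandated summit-side namespace (CONVENTIONS §2); for the
-- single-conjunct summit `ABC` the two coincide, so the duplicate `ABC.ABC` is deliberate.
set_option linter.dupNamespace false

namespace Summit.ABC.ABC.Theorems

/-- **Closes stmt-ABC-23404** (item `Assembly` of route `GaussianTwoDivision`):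
`GaussianNormTripleBound → TwoTorsionDictionary → GaussianPayoff → GaussianResidual → ABC`, by
the route's own `closes` (pure logic). Content-free; NOT abc progress — the crux
`GaussianNormTripleBound` is open and the residual is summit-strength, both hypotheses here, not
discharged. [folklore] -/
theorem gaussianTwoDivision_assembly_proof :
    Summit.ABC.ABC.Theses.GaussianTwoDivision.Assembly :=
  fun h₁ h₂ h₃ h₄ => Summit.ABC.ABC.Theses.GaussianTwoDivision.closes h₁ h₂ h₃ h₄

end Summit.ABC.ABC.Theorems
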